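import Mathlib
import HarnessLib
import Summits.AtomisticToContinuum.FouriersLaw.Theses.JunctionLocality
import Summits.AtomisticToContinuum.FouriersLaw.Theorems.JunctionLocalitySuperadditiveResistanceDeviceLiouville
import Summits.AtomisticToContinuum.FouriersLaw.Theorems.JunctionLocalitySuperadditiveResistancePlainAdjoint

/-!
# Kubo link, helper I: momentum-flip calculus and the weak image of a flipped forward field
(stub `stub_plainKuboLink` of line `floating-probe-bypass-laplacian`, crux stmt-AtomisticToContinuum-11748)

First helper file towards the stub `stub_plainKuboLink` (the finite-volume Kubo formula
`D_L/(L−1) = γ(1 − (γ/T²)⟨g, p_0² − T⟩_{μ_T})` for the plain `L`-chain). The NESS-side content of the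
stub is the open route item `BoundaryEscapeDeficit.ResponseIdentity` (stmt-AtomisticToContinuum-12237:
`D_L = (L−1)·γ·E_L`, `E_L = 1 − (γ/T²)∫₀^∞ K_L`, `K_L(u) = ⟨p_0² − T, P_u(p_0² − T)⟩_{μ_T}`); the
EQUILIBRIUM-side content is the Green–Kubo identification `⟨g, p_0² − T⟩_{μ_T} = ∫₀^∞ K_L(u) du` for every
classical forward field `g` (`C² ∩ L²(μ_T)`, mean zero, `L_{T,T} g = −(p_0² − T)`), which these helper
files prove. This part is pure calculus under the momentum flip `Θ(q,p) = (q,−p)`: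

* `partialQ_flip`, `partialP_flip`, `partialP_partialP_flip` — `∂_q(f∘Θ) = (∂_q f)∘Θ`,
  `∂_p(f∘Θ) = −(∂_p f)∘Θ`, `∂_p²(f∘Θ) = (∂_p² f)∘Θ`;
* `liouvilleOp_flip`, `bathOp_flip`, `generator_flip` — `X_H(f∘Θ) = −(X_H f)∘Θ`, `S(f∘Θ) = (Sf)∘Θ`, hence
  `L_{T,T}(f∘Θ) = (L^† f)∘Θ` with the `μ_T`-adjoint `L^† = −X_H + γS`;
* `measurePreserving_flip_gibbsMeasure`, `integral_flip_gibbsMeasure` — `μ_T` is `Θ`-invariant;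
* `integral_generator_mul_flip_field` — for a classical solution `g ∈ C²` of `L_{T,T} g = −(p_0² − T)`:
  `∫ (L_{T,T} f)·(g∘Θ) dμ_T = −∫ f (p_0² − T) dμ_T` for all `f ∈ C_c^∞` (the flipped field is a weak
  solution of the ADJOINT equation, the form consumed by `plainResponseField_unique`).

References: Rey-Bellet 2006 (Open classical systems), Lemma 4.2 (`J L^† J = L`); Kundu–Dhar–Narayan 2009
(open-system Green–Kubo).
-/

noncomputable section

open MeasureTheory Filter Topology
open scoped ContDiff
open Literature.MathematicalPhysics.KineticTheory.HeatConduction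
open Summit.AtomisticToContinuum.FouriersLaw.Theorems.SuperadditiveResistance.DeviceLiouville
  (kin deviceGenerator liouvilleOp bathOp generator_eq_liouvilleOp_add integral_generator_mul_eq_adjoint)

namespace Summit.AtomisticToContinuum.FouriersLaw.Cruxes.SuperadditiveResistance.FloatingProbeBypassLaplacian

variable {L : ℕ}

/-! ## Coordinate derivatives under the momentum flip -/

/-- `update (−p) i (−t) = −(update p i t)`. -/
theorem update_neg_eq (p : Fin L → ℝ) (i : Fin L) (t : ℝ) :
    Function.update (-p) i (-t) = -Function.update p i t := by
  funext j
  by_cases h : j = i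
  · subst h; simp
  · simp [Function.update_of_ne h]

/-- `∂_{q_i}(f∘Θ) = (∂_{q_i} f)∘Θ`. -/
theorem partialQ_flip (i : Fin L) (f : PhaseSpace L → ℝ) (x : PhaseSpace L) :
    partialQ i (fun y => f (y.1, -y.2)) x = partialQ i f (x.1, -x.2) := rfl

/-- `∂_{p_i}(f∘Θ) = −(∂_{p_i} f)∘Θ`. -/
theorem partialP_flip (i : Fin L) (f : PhaseSpace L → ℝ) (x : PhaseSpace L) :
    partialP i (fun y => f (y.1, -y.2)) x = -partialP i f (x.1, -x.2) := by
  unfold partialP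
  dsimp only
  have h : (fun t => f (x.1, -Function.update x.2 i t)) =
      fun t => f (x.1, Function.update (-x.2) i (-t)) := by
    funext t
    rw [update_neg_eq]
  rw [h]
  refine (deriv_comp_neg (fun s => f (x.1, Function.update (-x.2) i s)) (x.2 i)).trans ?_
  simp

/-- `∂_{p_i}²(f∘Θ) = (∂_{p_i}² f)∘Θ`. -/
theorem partialP_partialP_flip (i : Fin L) (f : PhaseSpace L → ℝ) (x : PhaseSpace L) :
    partialP i (partialP i (fun y => f (y.1, -y.2))) x = partialP i (partialP i f) (x.1, -x.2) := by
  have h1 : partialP i (fun y => f (y.1, -y.2)) = fun y => (fun z => -partialP i f z) (y.1, -y.2) :=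
    funext fun y => partialP_flip i f y
  rw [h1, partialP_flip i (fun z => -partialP i f z) x]
  unfold partialP
  simp only [deriv.fun_neg, neg_neg]

/-! ## The generator under the momentum flip -/

/-- `∂_{q_i} H` is even in the momenta. -/
theorem partialQ_hamiltonian_flip' (P : OscillatorChain) (x : PhaseSpace L) (i : Fin L) :
    partialQ i (P.hamiltonian L) (x.1, -x.2) = partialQ i (P.hamiltonian L) x := by
  rw [P.partialQ_hamiltonian_eq, P.partialQ_hamiltonian_eq]

/-- `X_H(f∘Θ) = −(X_H f)∘Θ`: the Hamiltonian vector field is odd under the momentum flip. -/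
theorem liouvilleOp_flip (P : OscillatorChain) (f : PhaseSpace L → ℝ) (x : PhaseSpace L) :
    liouvilleOp P L (fun y => f (y.1, -y.2)) x = -liouvilleOp P L f (x.1, -x.2) := by
  unfold liouvilleOp
  rw [← Finset.sum_neg_distrib]
  refine Finset.sum_congr rfl fun i _ => ?_
  rw [partialQ_flip, partialP_flip, partialQ_hamiltonian_flip' P x i]
  simp only [Pi.neg_apply]
  ring

/-- `S_B(f∘Θ) = (S_B f)∘Θ`: the Ornstein–Uhlenbeck thermostats are even under the momentum flip. -/
theorem bathOp_flip (B : Fin L → ℝ) (T : ℝ) (f : PhaseSpace L → ℝ) (x : PhaseSpace L) :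
    bathOp L B T (fun y => f (y.1, -y.2)) x = bathOp L B T f (x.1, -x.2) := by
  unfold bathOp
  refine Finset.sum_congr rfl fun i _ => ?_
  rw [partialP_partialP_flip, partialP_flip]
  simp only [Pi.neg_apply]
  ring

/-- **`L_{T,T}(f∘Θ) = (L^† f)∘Θ`** with `L^† = −X_H + γ S` the `μ_T`-adjoint of the plain generator
(Rey-Bellet 2006, Lemma 4.2 at equal temperatures). -/
theorem generator_flip (P : OscillatorChain) (T : ℝ) (f : PhaseSpace L → ℝ) (x : PhaseSpace L) :
    P.generator L T T (fun y => f (y.1, -y.2)) x =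
      -liouvilleOp P L f (x.1, -x.2) + P.γ * bathOp L (OscillatorChain.bathWeight L) T f (x.1, -x.2) := by
  rw [generator_eq_liouvilleOp_add, liouvilleOp_flip, bathOp_flip]

/-- Dually: `(L_{T,T} f)∘Θ = L^†(f∘Θ)`, i.e. `−X_H(f∘Θ) + γS(f∘Θ)` evaluated at `x` is `(L f)(Θx)`. -/
theorem adjoint_flip_eq_generator (P : OscillatorChain) (T : ℝ) (f : PhaseSpace L → ℝ)
    (x : PhaseSpace L) :
    -liouvilleOp P L (fun y => f (y.1, -y.2)) x +
        P.γ * bathOp L (OscillatorChain.bathWeight L) T (fun y => f (y.1, -y.2)) x =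
      P.generator L T T f (x.1, -x.2) := by
  rw [generator_eq_liouvilleOp_add, liouvilleOp_flip, bathOp_flip, neg_neg]

/-- The kinetic observables `p_s²` are even under the momentum flip. -/
theorem kin_flip (s : ℕ) (x : PhaseSpace L) : kin L s (x.1, -x.2) = kin L s x := by
  unfold kin
  simp

/-- `f∘Θ` is `C^n` if `f` is. -/
theorem contDiff_flip {n : WithTop ℕ∞} {f : PhaseSpace L → ℝ} (hf : ContDiff ℝ n f) :
    ContDiff ℝ n fun y : PhaseSpace L => f (y.1, -y.2) :=
  hf.comp (contDiff_fst.prodMk contDiff_snd.neg)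

/-- `f∘Θ` has compact support if `f` has. -/
theorem hasCompactSupport_flip {f : PhaseSpace L → ℝ} (hf : HasCompactSupport f) :
    HasCompactSupport fun y : PhaseSpace L => f (y.1, -y.2) := by
  have h : (fun y : PhaseSpace L => f (y.1, -y.2)) = f ∘ (momentumReversal L) := by
    funext y; simp
  rw [h]
  exact hf.comp_homeomorph ((Homeomorph.refl (Fin L → ℝ)).prodCongr (Homeomorph.neg (Fin L → ℝ)))

/-! ## `Θ`-invariance of the Gibbs measure -/

/-- The Gibbs density is even in the momenta. -/
theorem gibbsDensity_flip (P : OscillatorChain) (T : ℝ) (x : PhaseSpace L) :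
    P.gibbsDensity L T (x.1, -x.2) = P.gibbsDensity L T x := by
  unfold OscillatorChain.gibbsDensity
  rw [P.hamiltonian_neg_momentum]

/-- **The momentum flip preserves the Gibbs measure** (the density `e^{−H/T}` is even and Lebesgue
measure is flip-invariant). -/
theorem measurePreserving_flip_gibbsMeasure (P : OscillatorChain) (L : ℕ) (T : ℝ) :
    MeasurePreserving (momentumReversal L) (P.gibbsMeasure L T) (P.gibbsMeasure L T) := by
  set e := momentumReversal L with he_def
  have he : MeasurePreserving e volume volume := measurePreserving_momentumReversal L
  refine ⟨e.measurable, ?_⟩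
  set d : PhaseSpace L → ENNReal := fun x => ENNReal.ofReal (Real.exp (-P.hamiltonian L x / T) /
    ∫ y, Real.exp (-P.hamiltonian L y / T) ∂(volume : Measure (PhaseSpace L))) with hd
  have hμ : P.gibbsMeasure L T = (volume : Measure (PhaseSpace L)).withDensity d := rfl
  have hde : ∀ x, d (e x) = d x := by
    intro x
    simp only [hd, he_def, momentumReversal_apply, P.hamiltonian_neg_momentum]
  rw [hμ]
  ext A hA
  rw [Measure.map_apply e.measurable hA, withDensity_apply _ (e.measurable hA), withDensity_apply _ hA,
    ← lintegral_indicator (e.measurable hA), ← lintegral_indicator hA]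
  have hind : (fun x => (e ⁻¹' A).indicator d x) = fun x => A.indicator d (e x) := by
    funext x
    by_cases hx : e x ∈ A
    · rw [Set.indicator_of_mem (show x ∈ e ⁻¹' A from hx), Set.indicator_of_mem hx, hde]
    · rw [Set.indicator_of_notMem (show x ∉ e ⁻¹' A from hx), Set.indicator_of_notMem hx]
  rw [hind]
  exact he.lintegral_comp_emb e.measurableEmbedding _

/-- `∫ F∘Θ dμ_T = ∫ F dμ_T`. -/
theorem integral_flip_gibbsMeasure (P : OscillatorChain) (L : ℕ) (T : ℝ) (F : PhaseSpace L → ℝ) :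
    ∫ x, F (x.1, -x.2) ∂(P.gibbsMeasure L T) = ∫ x, F x ∂(P.gibbsMeasure L T) := by
  have h := (measurePreserving_flip_gibbsMeasure P L T).integral_comp'
    (f := momentumReversal L) F
  simpa using h

/-- `F∘Θ ∈ L^p(μ_T)` if `F ∈ L^p(μ_T)`. -/
theorem memLp_flip_gibbsMeasure (P : OscillatorChain) (L : ℕ) (T : ℝ) {p : ENNReal}
    {F : PhaseSpace L → ℝ} (hF : MemLp F p (P.gibbsMeasure L T)) :
    MemLp (fun x => F (x.1, -x.2)) p (P.gibbsMeasure L T) := by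
  have h := hF.comp_measurePreserving (measurePreserving_flip_gibbsMeasure P L T)
  have e : F ∘ (momentumReversal L) = fun x : PhaseSpace L => F (x.1, -x.2) := by
    funext x; simp
  rwa [e] at h

/-- `F∘Θ` is `μ_T`-integrable if `F` is. -/
theorem integrable_flip_gibbsMeasure (P : OscillatorChain) (L : ℕ) (T : ℝ) {F : PhaseSpace L → ℝ}
    (hF : Integrable F (P.gibbsMeasure L T)) :
    Integrable (fun x => F (x.1, -x.2)) (P.gibbsMeasure L T) := by
  have h := (measurePreserving_flip_gibbsMeasure P L T).integrable_comp_of_integrable hF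
  have e : F ∘ (momentumReversal L) = fun x : PhaseSpace L => F (x.1, -x.2) := by
    funext x; simp
  rwa [e] at h

/-! ## The weak (adjoint) image of a flipped classical forward field -/

/-- **A flipped classical forward field is a weak solution of the adjoint equation.** For the pinned
chain (`ω₂ > 0`, `lam, β ≥ 0`), `T > 0`, and a `C²` classical solution `g` of
`L_{T,T} g = −(p_s² − T)` (`kin L s = p_s²`): for every `f ∈ C²_c`,
`∫ (L_{T,T} f)·(g∘Θ) dμ_T = −∫ f·(p_s² − T) dμ_T` — by the `μ_T`-adjoint identity
`∫ (L f) h ρ_T = ∫ f (L^† h) ρ_T` (`integral_generator_mul_eq_adjoint`) and `L^†(g∘Θ) = (L g)∘Θ`. -/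
theorem integral_generator_mul_flip_field {ω₂ lam β : ℝ} (γ : ℝ) {T : ℝ}
    (hT : 0 < T) (s : ℕ) {g : PhaseSpace L → ℝ} (hg : ContDiff ℝ 2 g)
    (hpde : ∀ x, (pinnedChain ω₂ lam β γ).generator L T T g x = -(kin L s x - T))
    {f : PhaseSpace L → ℝ} (hf : ContDiff ℝ 2 f) (hfc : HasCompactSupport f) :
    ∫ x, (pinnedChain ω₂ lam β γ).generator L T T f x * g (x.1, -x.2)
        ∂((pinnedChain ω₂ lam β γ).gibbsMeasure L T) =
      -∫ x, f x * (kin L s x - T) ∂((pinnedChain ω₂ lam β γ).gibbsMeasure L T) := by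
  set P := pinnedChain ω₂ lam β γ with hP
  have hU1 : ContDiff ℝ 1 P.U := pinnedChain_contDiff_U ω₂ lam β γ
  have hV1 : ContDiff ℝ 1 P.V := pinnedChain_contDiff_V ω₂ lam β γ
  have hgf : ContDiff ℝ 2 fun y : PhaseSpace L => g (y.1, -y.2) := contDiff_flip hg
  rw [P.integral_gibbsMeasure, P.integral_gibbsMeasure, ← mul_neg, ← integral_neg]
  congr 1
  have hadj := integral_generator_mul_eq_adjoint P hU1 hV1 L hT.ne' hf hfc hgf
  have e1 : (fun x => P.generator L T T f x * g (x.1, -x.2) * P.gibbsDensity L T x) =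
      fun x => P.generator L T T f x * (g (x.1, -x.2) * P.gibbsDensity L T x) := by
    funext x; ring
  rw [e1, hadj]
  refine integral_congr_ae (ae_of_all _ fun x => ?_)
  dsimp only
  rw [adjoint_flip_eq_generator P T g x, hpde (x.1, -x.2), kin_flip]
  ring

/-! ## Registered helper sub-goal -/

/-- Registered helper sub-goal `helper_plainKuboFlip` (= `integral_generator_mul_flip_field` in stub form):
the flipped classical forward field of `p_s² − T` is a weak solution of the adjoint equation,
`∫ (L_{T,T} f)·(g∘Θ) dμ_T = −∫ f·(p_s² − T) dμ_T` for `f ∈ C²_c`. -/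
theorem helper_plainKuboFlip : ∀ {L : ℕ} {ω₂ lam β : ℝ} (γ : ℝ) {T : ℝ}, 0 < T → ∀ (s : ℕ) {g : PhaseSpace L → ℝ}, ContDiff ℝ 2 g → (∀ x, (pinnedChain ω₂ lam β γ).generator L T T g x = -(kin L s x - T)) → ∀ {f : PhaseSpace L → ℝ}, ContDiff ℝ 2 f → HasCompactSupport f → ∫ x, (pinnedChain ω₂ lam β γ).generator L T T f x * g (x.1, -x.2) ∂((pinnedChain ω₂ lam β γ).gibbsMeasure L T) = -∫ x, f x * (kin L s x - T) ∂((pinnedChain ω₂ lam β γ).gibbsMeasure L T) :=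
  fun γ _ hT s _ hg hpde _ hf hfc => integral_generator_mul_flip_field γ hT s hg hpde hf hfc

end Summit.AtomisticToContinuum.FouriersLaw.Cruxes.SuperadditiveResistance.FloatingProbeBypassLaplacian

end
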